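import Summits.QuantumFields.YangMills.Theorems.BalabanUVNodesN18SmearedSliceLetters
import Summits.QuantumFields.YangMills.Theorems.BalabanUVNodesN18KingModelLineReadouts
import Summits.QuantumFields.YangMills.Theorems.BalabanUVNodesN18VertexGraphBrackets

/-!
# BalabanUVNodes ∕ N18 — SMEARED SLICE READ-OUTS: the N18 slots fed BY NAME from King's printed Proposition 3.9 (3.73) WITH
# BACKGROUND — (§1) three-factor read-outs whose MIDDLE kernel reads the couplings and the background (the (g, U)-threaded
# twin of `N18VertexGraphBrackets.ne5_of_vertexGraphRates`), (§2) the END's cube-pair slot `N18KingModelLineReadouts.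
# ne5_reFunctional_of_fieldCubePairs` on block-smeared slice sums of per-configuration two-spacing data, diagonal pairs included,
# (§3) the three-factor U-reading rung BY NAME — rows ∕ columns abstract, MIDDLE = block-smeared slice sums under (3.63)∕(3.73)
# (Track A, DAG node N18 = NE5 `T4OutputRate.NE5 EA EB W κ θ C₅` :211; director-ym R134 row n18 s3 «King-model transfer
# `N18KingModelTorus` (κ, C₅ from (d, L, a, m², γ)) → `TwoRunTorusNE5Final*`», dag-lead DEDUP-232 clause s3″ «U-READING BY
# NAME, CUBE-PAIR SMEARED (diagonal included)»; module 10b of seat pub-ymgap-dag-n18-e; module 10a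
# `BalabanUVNodesN18SmearedSliceLetters` supplies the letters)

HONEST FRAMING.  Count-neutral kernel bookkeeping (seat pub-ymgap-dag-n18-e g6, strategy s3; `--supports` K3′
`SpineGivenEndpointR12`, helper).  §1 is elementary real analysis around the cell's hypothesis SHAPE `T4OutputRate.NE5` (every
row, kernel, column, rate and modulus a HYPOTHESIS); §2's input is the HYPOTHESIS SCHEMA `King1986.SlicePropagator.Prop39Printed`
— C. King's Proposition 3.9 for the U(1)-Higgs model in `d = 2, 3` WITH a regular background `A` ([King1986] p. 665, printed
AND proved in print), typed over ABSTRACT two-spacing data by the cell's literature seat (FILE C) — ONE SCHEMA PER CONFIGURATION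
the END reads.  Nothing of King's is proved and nothing of Bałaban's: NOT the covariant `G_k(U)` of
[Balaban1985BackgroundPropagators], NOT Bałaban's one-step outputs `E^{(j)}(X; g, U_k(V))` of [Balaban1987RG1] (0.24)∕(2.13),
for which NE5 is NOT IN PRINT and has no tree producer (NODE O instance 0∕1); no instance of the schema; NOT a node discharge;
finite tori; nothing continuum ∕ ℝ⁴ ∕ OS ∕ mass-gap ∕ Clay.  THEOREMS ONLY: 0 `def`, 0 `sorry`, standard axioms.

THE POINT.  (§1) 6a `N18VertexGraphBrackets.ne5_of_vertexGraphRates` (p480177) threads `(g, U)` through the ROWS and COLUMNS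
of a three-factor read-out `u ⬝ (C v)` and keeps the middle kernels `C_A(X)`, `C_B(X)` background-FREE — faithful to the
`A = 0` model of record (`king_cov_decay_torus` has no background), announced as «slot openable on request» (pub-ymgap INBOX
[DAGN18E-G5-ANSWER-LENS-T6′ (b′)]).  **`ne5_of_vertexGraphRatesBg`** opens it: `C_A g U X`, `C_B g U X` read the couplings and
the background, run A's at the TRANSPORTED background where `NE5` compares; envelopes `hCA`∕`hCB` and the one-line rate `hdC`
are asked `∀ g U` — the same proof (`N18KingModelScales.bilin3_rate` is pointwise in `X`); `decayBound_of_vertexGraphBg` is the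
(0.25) twin.  This is the slot a King-WITH-BACKGROUND middle line (module 10a's smeared letters of (3.63)∕(3.73), one schema per
background) inhabits; §3 **`ne5_of_smearedSliceGraphs`** assembles it: the THREE-FACTOR U-READING RUNG BY NAME (rows ∕ columns in
abstract (3.71)-slots, MIDDLE = block-smeared slice sums of per-(g, U, X) two-spacing data under the two schemas).
(§2) **`ne5_reFunctional_of_smearedSlicePairs`** — THE END'S CUBE-PAIR SLOT FED BY NAME FROM (3.73), DIAGONAL INCLUDED: on the
END's carriers `TwoRunTorusNE5.torusCarriers N W` ∕ `reFunctional` (transport = identity, both runs read the SAME configuration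
`φ ∈ (W j).sp2 X`), let each domain `⟨j, X⟩` and configuration `φ` carry King two-spacing slice data `T X φ : TwoSpacing 4` at
level `k = j`, block size `L ≥ 2`, obeying `Prop39Printed (T X φ) C δ₀ γ` (`0 ≤ γ ≤ 1`); let the line of a pair of cubes
`(p, q) ∈ X × X` be the BLOCK-SMEARED SLICE SUM `Σ_{i<j} Σ_{(x′,y′) ∈ T_{pq}} w·G_{(i)}` over a finite family `T_{pq}(X, φ)` of
fine point pairs with weights `w ≥ 0` under the volume bound `Σ w·e^{−δ₀|x−y|∕(2L^iη)} ≤ B·(L^iη)^4` (module 7's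
`gaussianBlockVolume_le` on the torus) whose coarse images sit at distance `≥ c₀·(tree length of X)` (`c₀ > 0`; module 1's
selection gives `c₀ = 1∕4`; pairs not so located get `T_{pq} = ∅`), run A reading the COARSE kernels at the points under run B's
fine points (p. 664 «x′ ∈ B^n(x)») and run B the fine kernels; if the two read-outs differ by the sum of these lines over ALL
pairs of cubes of `X`, then `NE5 (torusCarriers N W) (reFunctional … K_A) (reFunctional … K_B) W′ (δ₀c₀∕2) (L^{−γ})
((C·B)·(4·2⁴)²·(2!(2∕(δ₀c₀))²e^{δ₀c₀∕2}))` — by `twoSpacing_smearedNE5Letter_of_prop39` (10a) in the `hG` slot of 4a's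
`ne5_reFunctional_of_fieldCubePairs` (p469937).  The diagonal `p = q` and adjacent cubes are covered by the same letter (volume
gain), which is what the lens card T6′ adds over the pointwise reading; rate `θ = L^{−γ}`, decay `δ₀c₀∕2`.
WHAT THIS DOES NOT DO.  The two-spacing data, the schema, the pair families, weights and volume bound are HYPOTHESES (no
instance: the tree's `A = 0` King material reads the massive minimiser kernels — modules 4b∕5c — not the slice decomposition);
the external kernels (3.71) and the sup letters (3.63) enter only §1's abstract slots; `g` is unread in §2 (the END's carriers
read the configuration, not the couplings); NOT Bałaban's `E^{(j)}(X; g, U)`.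

Sources: C. King, Commun. Math. Phys. **102** (1986) 649–677 [King1986] — (2.17) p. 653, Thm 3.3 p. 655 ((3.6)–(3.8) p. 656),
Prop. 3.7 (3.63) p. 663, p. 664 («x′ ∈ B^n(x)»), Prop. 3.9 (3.73) p. 665, (4.41)–(4.43) p. 675; T. Bałaban, Commun. Math. Phys.
**109** (1987) 249–301 [Balaban1987RG1] — (0.24)–(0.25) p. 257, Thm 1 p. 259; **116** (1988) 1–22 [Balaban1988RG2Cluster] (2.30)
p. 18.  No claim about the mass gap.
-/

noncomputable section

namespace Summit.QuantumFields.YangMills.BalabanUVNodes.N18SmearedSliceReadouts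

open Real Matrix
open Literature.MathematicalPhysics.QuantumFieldTheory.Balaban1983to89
open Literature.MathematicalPhysics.QuantumFieldTheory.Balaban1983to89.T4OutputRate (Carriers Functional NE5 DecayBound)
open Literature.MathematicalPhysics.QuantumFieldTheory.Balaban1983to89.TreeLengthTorus
  (TPt TDom torusTreeLen torusTreeLen_nonneg)
open Literature.MathematicalPhysics.QuantumFieldTheory.Balaban1983to89.B13Lemma3Torus (TwoTorusStep)
open Literature.MathematicalPhysics.QuantumFieldTheory.King1986.SlicePropagator
  (TwoSpacing Prop37Printed Prop38Printed Prop39Printed)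
open Summit.QuantumFields.BalabanUV.T4Continuum.Spine.NE5.TwoRunTorusNE5 (torusCarriers reFunctional)
open Summit.QuantumFields.YangMills.BalabanUVNodes.N18KingModelScales (bilin_decay_bound bilin3_rate)
open Summit.QuantumFields.YangMills.BalabanUVNodes.N18KingModelLineReadouts (ne5_reFunctional_of_fieldCubePairs)
open Summit.QuantumFields.YangMills.BalabanUVNodes.N18SmearedSliceLetters
  (sliceKernels_smearedSupLetter_of_prop37 twoSpacing_smearedNE5Letter_of_prop39 twoSpacing_smearedSupLetter_hi
    rpow_neg_mul_natCast theta_pos_le_one)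

/-! ## §1 Three-factor read-outs whose MIDDLE kernel reads (g, U): the slot (b′) opened -/

section MiddleBg

variable {C : Carriers} {β : ℕ → Type*} [∀ j, Fintype (β j)] {P : ℕ → Type*}

/-- **`NE5` FOR THREE-FACTOR READ-OUTS ALL OF WHOSE FACTORS READ (g, U)** (the (g, U)-threaded-middle twin of 6a
`N18VertexGraphBrackets.ne5_of_vertexGraphRates`): `E_A g U X = u_A(g,U,X) ⬝ (C_A(g,U,X) v_A(g,U,X))`, `E_B` likewise; run A's
row, MIDDLE and column are read AT THE TRANSPORTED background `C.transport U` (where NE5 compares), run B's at `U`; sizes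
`a, c, c, b`, one-line rates `cA·θ^j`, `cC·θ^j`, `cB·θ^j` between run B's lines and run A's transported lines — all asked
`∀ g U` — common decay `κ` through the positions, lattice sums `V` ⟹ `NE5 EA EB W (κ∕2) θ ((cA·c·b + a·cC·b + a·c·cB)·V²)`.
The slot a King-with-background middle line inhabits (one printed schema per background: module 10a's smeared letters).
[cite: King1986, Prop. 3.9 (3.73) p.665, (4.42)–(4.43) p.675] -/
theorem ne5_of_vertexGraphRatesBg (ρ : (j : ℕ) → P j → P j → ℝ) (hρ0 : ∀ j p q, 0 ≤ ρ j p q)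
    (hρtri : ∀ j p q r, ρ j p r ≤ ρ j p q + ρ j q r) (q : (j : ℕ) → β j → P j)
    (p r : (X : C.Dom) → P (C.scale X))
    (uA vA : (ℕ → ℝ) → C.BgA → (X : C.Dom) → β (C.scale X) → ℝ)
    (uB vB : (ℕ → ℝ) → C.BgB → (X : C.Dom) → β (C.scale X) → ℝ)
    (CA : (ℕ → ℝ) → C.BgA → (X : C.Dom) → Matrix (β (C.scale X)) (β (C.scale X)) ℝ)
    (CB : (ℕ → ℝ) → C.BgB → (X : C.Dom) → Matrix (β (C.scale X)) (β (C.scale X)) ℝ)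
    {κ θ a c b cA cC cB V : ℝ} (hκ : 0 ≤ κ) (hθ : 0 ≤ θ) (ha : 0 ≤ a) (hc : 0 ≤ c) (hb : 0 ≤ b)
    (hcA : 0 ≤ cA) (hcC : 0 ≤ cC) (hcB : 0 ≤ cB)
    (hu : ∀ g U X z, |uA g (C.transport U) X z| ≤ a * Real.exp (-(κ * ρ _ (p X) (q _ z))))
    (hCA : ∀ g U X z w, |CA g (C.transport U) X z w| ≤ c * Real.exp (-(κ * ρ _ (q _ z) (q _ w))))
    (hCB : ∀ g U X z w, |CB g U X z w| ≤ c * Real.exp (-(κ * ρ _ (q _ z) (q _ w))))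
    (hv : ∀ g U X w, |vB g U X w| ≤ b * Real.exp (-(κ * ρ _ (q _ w) (r X))))
    (hdu : ∀ g U X z, |uB g U X z - uA g (C.transport U) X z|
      ≤ cA * θ ^ C.scale X * Real.exp (-(κ * ρ _ (p X) (q _ z))))
    (hdC : ∀ g U X z w, |CB g U X z w - CA g (C.transport U) X z w|
      ≤ cC * θ ^ C.scale X * Real.exp (-(κ * ρ _ (q _ z) (q _ w))))
    (hdv : ∀ g U X w, |vB g U X w - vA g (C.transport U) X w|
      ≤ cB * θ ^ C.scale X * Real.exp (-(κ * ρ _ (q _ w) (r X))))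
    (hV : ∀ j (s : P j), ∑ z, Real.exp (-(κ / 2 * ρ j s (q j z))) ≤ V)
    (hd : ∀ X, C.d X ≤ ρ _ (p X) (r X))
    {EA : Functional C C.BgA} {EB : Functional C C.BgB}
    (hEA : ∀ g U X, EA g U X = uA g U X ⬝ᵥ (CA g U X *ᵥ vA g U X))
    (hEB : ∀ g U X, EB g U X = uB g U X ⬝ᵥ (CB g U X *ᵥ vB g U X)) (W : Set (ℕ → ℝ)) :
    NE5 EA EB W (κ / 2) θ ((cA * c * b + a * cC * b + a * c * cB) * V ^ 2) := by
  intro g _ U X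
  rw [hEA, hEB, abs_sub_comm]
  have hθj : 0 ≤ θ ^ C.scale X := pow_nonneg hθ _
  have h := bilin3_rate (ρ (C.scale X)) (hρ0 _) (hρtri _) (q _) (p X) (r X) (uA g (C.transport U) X) (uB g U X)
    (vA g (C.transport U) X) (vB g U X) (CA g (C.transport U) X) (CB g U X) hκ ha hc hb (mul_nonneg hcA hθj)
    (mul_nonneg hcC hθj) (mul_nonneg hcB hθj) (hu g U X) (hCA g U X) (hCB g U X) (hv g U X) (hdu g U X)
    (hdC g U X) (hdv g U X) (hV _)
  refine h.trans ?_
  have hV0 : 0 ≤ V := (Finset.sum_nonneg fun z _ => (Real.exp_pos _).le).trans (hV _ (p X))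
  have hK : 0 ≤ (cA * c * b + a * cC * b + a * c * cB) * V ^ 2 * θ ^ C.scale X := by positivity
  have hexp : Real.exp (-(κ / 2 * ρ _ (p X) (r X))) ≤ Real.exp (-(κ / 2 * C.d X)) :=
    Real.exp_le_exp.mpr (neg_le_neg (mul_le_mul_of_nonneg_left (hd X) (by positivity)))
  calc (cA * θ ^ C.scale X * c * b + a * (cC * θ ^ C.scale X) * b + a * c * (cB * θ ^ C.scale X)) * V ^ 2
          * Real.exp (-(κ / 2 * ρ _ (p X) (r X)))
      = (cA * c * b + a * cC * b + a * c * cB) * V ^ 2 * θ ^ C.scale X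
          * Real.exp (-(κ / 2 * ρ _ (p X) (r X))) := by ring
    _ ≤ (cA * c * b + a * cC * b + a * c * cB) * V ^ 2 * θ ^ C.scale X * Real.exp (-(κ / 2 * C.d X)) :=
        mul_le_mul_of_nonneg_left hexp hK

/-- **(0.25) FOR A THREE-FACTOR READ-OUT ALL OF WHOSE FACTORS READ (g, U)** (the (g, U)-threaded-middle twin of 6a
`N18VertexGraphBrackets.decayBound_of_vertexGraph`): `F g U X = u(g,U,X) ⬝ (E(g,U,X) v(g,U,X))` with `|u| ≤ a e^{−κρ(p X, q z)}`,
`|E| ≤ c e^{−κρ}`, `|v| ≤ b e^{−κρ(q w, r X)}` for ALL `(g, U)`, lattice sums `V`, `d X ≤ ρ(p X, r X)` ⟹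
`DecayBound F W (a·c·b·V²) (κ∕2)`. [cite: King1986, (4.41) p.675; Balaban1987RG1, (0.25) p.257] -/
theorem decayBound_of_vertexGraphBg (ρ : (j : ℕ) → P j → P j → ℝ) (hρ0 : ∀ j p q, 0 ≤ ρ j p q)
    (hρtri : ∀ j p q r, ρ j p r ≤ ρ j p q + ρ j q r) (q : (j : ℕ) → β j → P j)
    (p r : (X : C.Dom) → P (C.scale X)) {Bg : Type}
    (u v : (ℕ → ℝ) → Bg → (X : C.Dom) → β (C.scale X) → ℝ)
    (E : (ℕ → ℝ) → Bg → (X : C.Dom) → Matrix (β (C.scale X)) (β (C.scale X)) ℝ)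
    {κ a c b V : ℝ} (hκ : 0 ≤ κ) (ha : 0 ≤ a) (hc : 0 ≤ c) (hb : 0 ≤ b)
    (hu : ∀ g U X z, |u g U X z| ≤ a * Real.exp (-(κ * ρ _ (p X) (q _ z))))
    (hE : ∀ g U X z w, |E g U X z w| ≤ c * Real.exp (-(κ * ρ _ (q _ z) (q _ w))))
    (hv : ∀ g U X w, |v g U X w| ≤ b * Real.exp (-(κ * ρ _ (q _ w) (r X))))
    (hV : ∀ j (s : P j), ∑ z, Real.exp (-(κ / 2 * ρ j s (q j z))) ≤ V)
    (hd : ∀ X, C.d X ≤ ρ _ (p X) (r X))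
    (F : Functional C Bg) (hF : ∀ g U X, F g U X = u g U X ⬝ᵥ (E g U X *ᵥ v g U X)) (W : Set (ℕ → ℝ)) :
    DecayBound F W (a * c * b * V ^ 2) (κ / 2) := by
  intro g _ U X
  rw [hF]
  have h := bilin_decay_bound (ρ (C.scale X)) (hρ0 _) (hρtri _) (q _) (p X) (r X) (u g U X) (v g U X) (E g U X) hκ
    ha hc hb (hu g U X) (hE g U X) (hv g U X) (hV _)
  refine h.trans ?_
  have hV0 : 0 ≤ V := (Finset.sum_nonneg fun z _ => (Real.exp_pos _).le).trans (hV _ (p X))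
  have hK : 0 ≤ a * c * b * V ^ 2 := by positivity
  exact mul_le_mul_of_nonneg_left
    (Real.exp_le_exp.mpr (neg_le_neg (mul_le_mul_of_nonneg_left (hd X) (by positivity)))) hK

end MiddleBg

/-! ## §2 The END's cube-pair slot fed by name from (3.73): block-smeared slice sums, diagonal included -/

section EndCurrency

variable {L' : ℕ} [NeZero L']

/-- **THE END'S CUBE-PAIR SLOT FED BY NAME FROM KING'S PROPOSITION 3.9 (3.73) WITH BACKGROUND, DIAGONAL INCLUDED.**  END carriers
`torusCarriers N W`, read-outs `K_A, K_B` of the scale-`j` configuration `φ`; per domain `⟨j, X⟩` and configuration `φ` King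
two-spacing slice data `T X φ : TwoSpacing 4` at level `j`, block size `L ≥ 2`, with `Prop39Printed (T X φ) C δ₀ γ` (`0 ≤ C`,
`0 < δ₀`, `0 ≤ γ ≤ 1`); per pair of cubes `(p, q)` a finite family `Tpq X φ (p, q)` of fine point pairs with weights `w ≥ 0`
under the volume bound `∀ i < j, Σ w·e^{−δ₀|x−y|∕(2L^iη)} ≤ B·(L^iη)^4` and located at coarse distance `≥ c₀·(tree length of X)`
(`c₀ > 0`); the two read-outs differing by the sum over ALL pairs of cubes of `X` of the block-smeared slice sums, run A reading
the coarse kernels `G^η_{(i)}(x, y)` under run B's fine kernels `G^{η′}_{(i)}(x′, y′)` ⟹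
`NE5 (torusCarriers N W) (reFunctional N W K_A) (reFunctional N W K_B) W′ (δ₀c₀∕2) (L^{−γ}) ((C·B)·(4·2⁴)²·(2!(2∕(δ₀c₀))²e^{δ₀c₀∕2}))`
— module 10a `twoSpacing_smearedNE5Letter_of_prop39` in the `hG` slot of 4a `ne5_reFunctional_of_fieldCubePairs`.
[cite: King1986, Prop. 3.9 (3.73) p.665, (2.17) p.653, p.664; Balaban1987RG1, (0.24)-(0.25) p.257, Thm 1 p.259; Balaban1988RG2Cluster, (2.30) p.18] -/
theorem ne5_reFunctional_of_smearedSlicePairs (N : ℕ → ℕ) [∀ j, NeZero (N j)]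
    (W : (j : ℕ) → TwoTorusStep 4 L' (N j)) (KA KB : (X : Σ j : ℕ, TDom 4 (N j)) → (W X.1).Φ → ℝ)
    (T : (X : Σ j : ℕ, TDom 4 (N j)) → (W X.1).Φ → TwoSpacing 4) {L : ℕ} (hL : 2 ≤ L)
    (hTL : ∀ X φ, (T X φ).lo.L = L) (hTk : ∀ X φ, (T X φ).lo.k = X.1)
    {C δ₀ γ : ℝ} (hC : 0 ≤ C) (hδ₀ : 0 < δ₀) (hγ0 : 0 ≤ γ) (hγ1 : γ ≤ 1)
    (h39 : ∀ X φ, Prop39Printed (T X φ) C δ₀ γ)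
    (Tpq : (X : Σ j : ℕ, TDom 4 (N j)) → (φ : (W X.1).Φ) → TPt 4 (N X.1) × TPt 4 (N X.1) →
      Finset ((T X φ).hi.S × (T X φ).hi.S))
    (w : (X : Σ j : ℕ, TDom 4 (N j)) → (φ : (W X.1).Φ) → (T X φ).hi.S × (T X φ).hi.S → ℝ)
    (hw : ∀ X φ pq, ∀ xy ∈ Tpq X φ pq, 0 ≤ w X φ xy)
    {B : ℝ} (hB : 0 ≤ B)
    (hvol : ∀ X φ pq, ∀ i < (T X φ).lo.k, ∑ xy ∈ Tpq X φ pq, w X φ xy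
        * Real.exp (-(δ₀ * (T X φ).lo.dist ((T X φ).pt xy.1) ((T X φ).pt xy.2) / (2 * (T X φ).lo.slice i)))
      ≤ B * ((T X φ).lo.slice i) ^ (4 : ℝ))
    {c₀ : ℝ} (hc₀ : 0 < c₀)
    (hr : ∀ X φ pq, ∀ xy ∈ Tpq X φ pq,
      c₀ * torusTreeLen X.2.1 ≤ (T X φ).lo.dist ((T X φ).pt xy.1) ((T X φ).pt xy.2))
    (hK : ∀ X φ, KA X φ - KB X φ = ∑ pq ∈ X.2.1 ×ˢ X.2.1,
      ((∑ i ∈ Finset.range (T X φ).lo.k, ∑ xy ∈ Tpq X φ pq,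
          w X φ xy * (T X φ).lo.G i ((T X φ).pt xy.1) ((T X φ).pt xy.2))
        - (∑ i ∈ Finset.range (T X φ).lo.k, ∑ xy ∈ Tpq X φ pq, w X φ xy * (T X φ).hi.G i xy.1 xy.2)))
    (W' : Set (ℕ → ℝ)) :
    NE5 (C := torusCarriers N W) (reFunctional N W fun j X φ => ((KA ⟨j, X⟩ φ : ℝ) : ℂ))
      (reFunctional N W fun j X φ => ((KB ⟨j, X⟩ φ : ℝ) : ℂ)) W' (δ₀ * c₀ / 2) ((L : ℝ) ^ (-γ))
      (C * B * (4 * 2 ^ 4) ^ 2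
        * (((2 : ℕ).factorial : ℝ) * (2 / (δ₀ * c₀)) ^ 2 * Real.exp (δ₀ * c₀ / 2))) := by
  have hL1 : 1 ≤ L := by omega
  have hθ : 0 ≤ (L : ℝ) ^ (-γ) := (theta_pos_le_one hL1 hγ0).1.le
  refine ne5_reFunctional_of_fieldCubePairs N W KA KB
    (fun X φ pq => ∑ i ∈ Finset.range (T X φ).lo.k, ∑ xy ∈ Tpq X φ pq,
      w X φ xy * (T X φ).lo.G i ((T X φ).pt xy.1) ((T X φ).pt xy.2))
    (fun X φ pq => ∑ i ∈ Finset.range (T X φ).lo.k, ∑ xy ∈ Tpq X φ pq, w X φ xy * (T X φ).hi.G i xy.1 xy.2)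
    (mul_pos hδ₀ hc₀) hθ (mul_nonneg hC hB) hK (fun X φ pq _ => ?_) W'
  -- the line of the pair `pq`: the smeared two-run letter of (3.73) at radius `c₀ · treeLen X`
  have hLX : 2 ≤ (T X φ).lo.L := by rw [hTL]; exact hL
  have hr0 : 0 ≤ c₀ * torusTreeLen X.2.1 := mul_nonneg hc₀.le (torusTreeLen_nonneg _)
  have h := twoSpacing_smearedNE5Letter_of_prop39 (T X φ) hLX hC hδ₀ hγ1 (h39 X φ) (Tpq X φ pq) (w X φ)
    (hw X φ pq) hB hr0 (hr X φ pq) (hvol X φ pq)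
  rw [hTL, hTk] at h
  have hswap : (∑ i ∈ Finset.range X.1, ∑ xy ∈ Tpq X φ pq,
        w X φ xy * (T X φ).lo.G i ((T X φ).pt xy.1) ((T X φ).pt xy.2))
      - (∑ i ∈ Finset.range X.1, ∑ xy ∈ Tpq X φ pq, w X φ xy * (T X φ).hi.G i xy.1 xy.2)
      = -(∑ i ∈ Finset.range X.1, ∑ xy ∈ Tpq X φ pq,
          w X φ xy * ((T X φ).hi.G i xy.1 xy.2 - (T X φ).lo.G i ((T X φ).pt xy.1) ((T X φ).pt xy.2))) := by
    rw [← Finset.sum_sub_distrib, ← Finset.sum_neg_distrib]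
    refine Finset.sum_congr rfl fun i _ => ?_
    rw [← Finset.sum_sub_distrib, ← Finset.sum_neg_distrib]
    exact Finset.sum_congr rfl fun xy _ => by ring
  rw [hTk, hswap, abs_neg]
  calc _ ≤ _ := h
    _ = _ := by ring

end EndCurrency

/-! ## §3 The three-factor U-reading rung BY NAME: rows ∕ columns abstract, MIDDLE = block-smeared slice sums from (3.63)∕(3.73) -/

section ThreeFactor

variable {C : Carriers} {β : ℕ → Type*} [∀ j, Fintype (β j)] {P : ℕ → Type*} {d : ℕ}

/-- A located radius with slack: `e^{−δ·max(ρ − s, 0)} ≤ e^{δs}·e^{−δρ}` (`δ ≥ 0`). [folklore] -/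
theorem exp_neg_radius_slack {δ ρ s : ℝ} (hδ : 0 ≤ δ) :
    Real.exp (-(δ * max (ρ - s) 0)) ≤ Real.exp (δ * s) * Real.exp (-(δ * ρ)) := by
  rw [← Real.exp_add]
  apply Real.exp_le_exp.mpr
  have h : ρ - s ≤ max (ρ - s) 0 := le_max_left _ _
  nlinarith [mul_le_mul_of_nonneg_left h hδ]

/-- **The external-line slot read by name from (3.71)** (`Prop38Printed`, first line, in the `θ`-power currency of the `hdu`∕`hdv`
slots below): for a unit-lattice point `z`, `|a_{k+n}G^{η′}_{k+n}Q^*_{k+n}(x′, z) − a_kG^η_kQ^*_k(x, z)| ≤ C·(L^{−γ})^k·e^{−δ₀|x − z|}`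
(n15-e's `N15KingModelCurvedH.hEntry_le_of_prop38Printed` is the sup-over-the-block form). [cite: King1986, Prop. 3.8 (3.71) p.664] -/
theorem rowRate_of_prop38Printed (T : TwoSpacing d) {C δ₀ γ : ℝ} (h38 : Prop38Printed T C δ₀ γ) (x' : T.hi.S)
    (z : T.lo.S) (hz : T.IsUnit z) :
    |T.K' x' z - T.K (T.pt x') z| ≤ C * ((T.lo.L : ℝ) ^ (-γ)) ^ T.lo.k * Real.exp (-(δ₀ * T.lo.dist (T.pt x') z)) := by
  rw [← rpow_neg_mul_natCast]
  exact (h38.1 x' z hz).1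

/-- **THE THREE-FACTOR U-READING RUNG BY NAME, CUBE-PAIR SMEARED (row s3″).**  Any carriers `C`; cube index types `β j`,
positions `q_j : β j → P j` with a pseudo-distance `ρ_j` (triangle inequality), external positions `p X`, `r X` with
`C.d X ≤ ρ(p X, r X)`, lattice sums `V` at rate `δ₀∕2`.  Per couplings `g`, run-B background `U` and domain `X` of scale `j`, King
two-spacing slice data `T g U X : TwoSpacing d` at level `j`, block size `L ≥ 2`, with a NONNEGATIVE coarse distance, the schemas
`Prop37Printed (T g U X).lo C₇ δ₀` (3.63) and `Prop39Printed (T g U X) C₉ δ₀ γ` (3.73) (`0 ≤ γ ≤ 1`) DISPLAYED; per pair of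
cubes `(z, w)` a finite family of fine point pairs with weights `wt ≥ 0` under the volume bound `Σ wt·e^{−δ₀|x−y|∕(2L^iη)} ≤
B·(L^iη)^d`, whose coarse images sit at distance `≥ ρ(q z, q w) − s₀` (a slack `s₀`: points of two unit cubes).  The MIDDLE
kernels are the block-smeared slice sums — run A's `C_A g (transport U) X z w = Σ_{i<j} Σ wt·G^η_{(i)}(x, y)` (coarse kernels at
the points under the fine ones), run B's `C_B g U X z w = Σ_{i<j} Σ wt·G^{η′}_{(i)}(x′, y′)`; rows ∕ columns are abstract with
envelopes `a, b` and one-line rates `cA·θ^j`, `cB·θ^j` at `θ = L^{−γ}`, decay `δ₀` (the slots of (3.71); `N15KingModelCurvedH.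
hEntry_le_of_prop38Printed` is their by-name reading).  THEN `NE5 EA EB W (δ₀∕2) (L^{−γ}) ((cA·c·b + a·cC·b + a·c·cB)·V²)` with
the middle letters `c = (C₇ + C₉)·B·e^{δ₀s₀}` (envelope of both runs: 10a `sliceKernels_smearedSupLetter_of_prop37`,
`twoSpacing_smearedSupLetter_hi`) and `cC = C₉·B·e^{δ₀s₀}` (rate: 10a `twoSpacing_smearedNE5Letter_of_prop39`) — for EVERY pair
of cubes, coincident ones included, through §1 `ne5_of_vertexGraphRatesBg`.  One printed schema per background; no instance.
[cite: King1986, Prop. 3.7 (3.63) p.663, Prop. 3.9 (3.73) p.665, (2.17) p.653, (4.41)–(4.43) p.675] -/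
theorem ne5_of_smearedSliceGraphs (ρ : (j : ℕ) → P j → P j → ℝ) (hρ0 : ∀ j p q, 0 ≤ ρ j p q)
    (hρtri : ∀ j p q r, ρ j p r ≤ ρ j p q + ρ j q r) (q : (j : ℕ) → β j → P j)
    (p r : (X : C.Dom) → P (C.scale X))
    (uA vA : (ℕ → ℝ) → C.BgA → (X : C.Dom) → β (C.scale X) → ℝ)
    (uB vB : (ℕ → ℝ) → C.BgB → (X : C.Dom) → β (C.scale X) → ℝ)
    (CA : (ℕ → ℝ) → C.BgA → (X : C.Dom) → Matrix (β (C.scale X)) (β (C.scale X)) ℝ)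
    (CB : (ℕ → ℝ) → C.BgB → (X : C.Dom) → Matrix (β (C.scale X)) (β (C.scale X)) ℝ)
    (T : (ℕ → ℝ) → C.BgB → C.Dom → TwoSpacing d) {L : ℕ} (hL : 2 ≤ L)
    (hTL : ∀ g U X, (T g U X).lo.L = L) (hTk : ∀ g U X, (T g U X).lo.k = C.scale X)
    (hdist : ∀ g U X x y, 0 ≤ (T g U X).lo.dist x y)
    {C₇ C₉ δ₀ γ : ℝ} (hC₇ : 0 ≤ C₇) (hC₉ : 0 ≤ C₉) (hδ₀ : 0 < δ₀) (hγ0 : 0 ≤ γ) (hγ1 : γ ≤ 1)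
    (h37 : ∀ g U X, Prop37Printed (T g U X).lo C₇ δ₀) (h39 : ∀ g U X, Prop39Printed (T g U X) C₉ δ₀ γ)
    (Tpq : (g : ℕ → ℝ) → (U : C.BgB) → (X : C.Dom) → β (C.scale X) → β (C.scale X) →
      Finset ((T g U X).hi.S × (T g U X).hi.S))
    (wt : (g : ℕ → ℝ) → (U : C.BgB) → (X : C.Dom) → (T g U X).hi.S × (T g U X).hi.S → ℝ)
    (hw : ∀ g U X z w, ∀ xy ∈ Tpq g U X z w, 0 ≤ wt g U X xy)
    {B : ℝ} (hB : 0 ≤ B)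
    (hvol : ∀ g U X z w, ∀ i < (T g U X).lo.k, ∑ xy ∈ Tpq g U X z w, wt g U X xy
        * Real.exp (-(δ₀ * (T g U X).lo.dist ((T g U X).pt xy.1) ((T g U X).pt xy.2)
            / (2 * (T g U X).lo.slice i)))
      ≤ B * ((T g U X).lo.slice i) ^ (d : ℝ))
    {s₀ : ℝ}
    (hr : ∀ g U X z w, ∀ xy ∈ Tpq g U X z w,
      ρ _ (q _ z) (q _ w) ≤ (T g U X).lo.dist ((T g U X).pt xy.1) ((T g U X).pt xy.2) + s₀)
    (hCAT : ∀ g U X z w, CA g (C.transport U) X z w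
      = ∑ i ∈ Finset.range (T g U X).lo.k, ∑ xy ∈ Tpq g U X z w,
          wt g U X xy * (T g U X).lo.G i ((T g U X).pt xy.1) ((T g U X).pt xy.2))
    (hCBT : ∀ g U X z w, CB g U X z w
      = ∑ i ∈ Finset.range (T g U X).lo.k, ∑ xy ∈ Tpq g U X z w, wt g U X xy * (T g U X).hi.G i xy.1 xy.2)
    {a b cA cB V : ℝ} (ha : 0 ≤ a) (hb : 0 ≤ b) (hcA : 0 ≤ cA) (hcB : 0 ≤ cB)
    (hu : ∀ g U X z, |uA g (C.transport U) X z| ≤ a * Real.exp (-(δ₀ * ρ _ (p X) (q _ z))))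
    (hv : ∀ g U X w, |vB g U X w| ≤ b * Real.exp (-(δ₀ * ρ _ (q _ w) (r X))))
    (hdu : ∀ g U X z, |uB g U X z - uA g (C.transport U) X z|
      ≤ cA * ((L : ℝ) ^ (-γ)) ^ C.scale X * Real.exp (-(δ₀ * ρ _ (p X) (q _ z))))
    (hdv : ∀ g U X w, |vB g U X w - vA g (C.transport U) X w|
      ≤ cB * ((L : ℝ) ^ (-γ)) ^ C.scale X * Real.exp (-(δ₀ * ρ _ (q _ w) (r X))))
    (hV : ∀ j (s : P j), ∑ z, Real.exp (-(δ₀ / 2 * ρ j s (q j z))) ≤ V)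
    (hd : ∀ X, C.d X ≤ ρ _ (p X) (r X))
    {EA : Functional C C.BgA} {EB : Functional C C.BgB}
    (hEA : ∀ g U X, EA g U X = uA g U X ⬝ᵥ (CA g U X *ᵥ vA g U X))
    (hEB : ∀ g U X, EB g U X = uB g U X ⬝ᵥ (CB g U X *ᵥ vB g U X)) (W : Set (ℕ → ℝ)) :
    NE5 EA EB W (δ₀ / 2) ((L : ℝ) ^ (-γ))
      ((cA * ((C₇ + C₉) * B * Real.exp (δ₀ * s₀)) * b + a * (C₉ * B * Real.exp (δ₀ * s₀)) * b
        + a * ((C₇ + C₉) * B * Real.exp (δ₀ * s₀)) * cB) * V ^ 2) := by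
  have hL1 : 1 ≤ L := by omega
  obtain ⟨hθ0, hθ1⟩ := theta_pos_le_one hL1 hγ0
  have hc : 0 ≤ (C₇ + C₉) * B * Real.exp (δ₀ * s₀) := by positivity
  have hcC : 0 ≤ C₉ * B * Real.exp (δ₀ * s₀) := by positivity
  -- the located radius of the cube pair `(z, w)` with slack, and the three smeared letters there
  have key : ∀ g U X z w,
      |CA g (C.transport U) X z w| ≤ (C₇ + C₉) * B * Real.exp (δ₀ * s₀) * Real.exp (-(δ₀ * ρ _ (q _ z) (q _ w))) ∧
      |CB g U X z w| ≤ (C₇ + C₉) * B * Real.exp (δ₀ * s₀) * Real.exp (-(δ₀ * ρ _ (q _ z) (q _ w))) ∧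
      |CB g U X z w - CA g (C.transport U) X z w| ≤ C₉ * B * Real.exp (δ₀ * s₀) * ((L : ℝ) ^ (-γ)) ^ C.scale X
        * Real.exp (-(δ₀ * ρ _ (q _ z) (q _ w))) := by
    intro g U X z w
    have hLX : 2 ≤ (T g U X).lo.L := by rw [hTL]; exact hL
    set r₀ : ℝ := max (ρ _ (q _ z) (q _ w) - s₀) 0 with hr₀
    have hr0 : 0 ≤ r₀ := le_max_right _ _
    have hr' : ∀ xy ∈ Tpq g U X z w, r₀ ≤ (T g U X).lo.dist ((T g U X).pt xy.1) ((T g U X).pt xy.2) :=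
      fun xy hxy => max_le (by linarith [hr g U X z w xy hxy]) (hdist g U X _ _)
    have hslack : Real.exp (-(δ₀ * r₀)) ≤ Real.exp (δ₀ * s₀) * Real.exp (-(δ₀ * ρ _ (q _ z) (q _ w))) :=
      exp_neg_radius_slack hδ₀.le
    have hA := sliceKernels_smearedSupLetter_of_prop37 (T g U X).lo hLX hC₇ hδ₀ (h37 g U X) (Tpq g U X z w)
      (fun xy => (T g U X).pt xy.1) (fun xy => (T g U X).pt xy.2) (wt g U X) (hw g U X z w) hB hr0 hr'
      (hvol g U X z w)
    have hBr := twoSpacing_smearedSupLetter_hi (T g U X) hLX hC₇ hC₉ hδ₀ hγ0 hγ1 (h37 g U X) (h39 g U X)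
      (Tpq g U X z w) (wt g U X) (hw g U X z w) hB hr0 hr' (hvol g U X z w)
    have hD := twoSpacing_smearedNE5Letter_of_prop39 (T g U X) hLX hC₉ hδ₀ hγ1 (h39 g U X) (Tpq g U X z w)
      (wt g U X) (hw g U X z w) hB hr0 hr' (hvol g U X z w)
    rw [hTL, hTk] at hD
    have hdiff : CB g U X z w - CA g (C.transport U) X z w
        = ∑ i ∈ Finset.range (T g U X).lo.k, ∑ xy ∈ Tpq g U X z w, wt g U X xy
            * ((T g U X).hi.G i xy.1 xy.2 - (T g U X).lo.G i ((T g U X).pt xy.1) ((T g U X).pt xy.2)) := by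
      rw [hCBT, hCAT, ← Finset.sum_sub_distrib]
      refine Finset.sum_congr rfl fun i _ => ?_
      rw [← Finset.sum_sub_distrib]
      exact Finset.sum_congr rfl fun xy _ => by ring
    have hθk : 0 ≤ ((L : ℝ) ^ (-γ)) ^ C.scale X := pow_nonneg hθ0.le _
    refine ⟨?_, ?_, ?_⟩
    · rw [hCAT]
      calc _ ≤ C₇ * B * Real.exp (-(δ₀ * r₀)) := hA
        _ ≤ (C₇ + C₉) * B * (Real.exp (δ₀ * s₀) * Real.exp (-(δ₀ * ρ _ (q _ z) (q _ w)))) :=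
            mul_le_mul (by nlinarith) hslack (Real.exp_pos _).le (by positivity)
        _ = _ := by ring
    · rw [hCBT]
      calc _ ≤ (C₇ + C₉) * B * Real.exp (-(δ₀ * r₀)) := hBr
        _ ≤ (C₇ + C₉) * B * (Real.exp (δ₀ * s₀) * Real.exp (-(δ₀ * ρ _ (q _ z) (q _ w)))) :=
            mul_le_mul_of_nonneg_left hslack (by positivity)
        _ = _ := by ring
    · rw [hdiff, hTk]
      calc _ ≤ C₉ * B * ((L : ℝ) ^ (-γ)) ^ C.scale X * Real.exp (-(δ₀ * r₀)) := hD
        _ ≤ C₉ * B * ((L : ℝ) ^ (-γ)) ^ C.scale X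
              * (Real.exp (δ₀ * s₀) * Real.exp (-(δ₀ * ρ _ (q _ z) (q _ w)))) :=
            mul_le_mul_of_nonneg_left hslack (by positivity)
        _ = _ := by ring
  exact ne5_of_vertexGraphRatesBg ρ hρ0 hρtri q p r uA vA uB vB CA CB hδ₀.le hθ0.le ha hc hb hcA hcC hcB hu
    (fun g U X z w => (key g U X z w).1) (fun g U X z w => (key g U X z w).2.1) hv hdu
    (fun g U X z w => (key g U X z w).2.2) hdv hV hd hEA hEB W

end ThreeFactor

end Summit.QuantumFields.YangMills.BalabanUVNodes.N18SmearedSliceReadouts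

end
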